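import Literature.Probability.RandomPlanarGeometry.SAWBendingEnergy
import Literature.Probability.RandomPlanarGeometry.SAWSubBallisticMaxDisplacement
import HarnessLib

/-!
# Runs of step words and the first-block renewal inequality for the bending partition function

Topic `Literature/Probability/RandomPlanarGeometry` (continues `SAWBendingEnergy.lean`: `Zd.Zbend N t = Σ_{ω ∈ S_N} t^{turns}`,
`wturns`, `Zbend_eq_sum_sawWords`; uses `isSAW_map_of_linear` / `rotNegYX` of `SAWSubBallisticMaxDisplacement.lean`).

This is the combinatorial half of the lane «pcv-sawmu» route «STIFF», item S3 at `m = 4` (a-idea-2 gen 8, ROUTES §37,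
`STIFF_BLUEPRINT.md` §S3): an UPPER bound for the semi-flexible SAW partition function through SELF-AVOIDANCE OF THE FIRST
FOUR SEGMENTS ONLY. Source for the objects: N. Madras, G. Slade, *The Self-Avoiding Walk* (1993), §1.1 (step words),
§2.1 (variants / stiffness); the block bound itself is elementary and (in this explicit form) the lane's.

## Contents (namespace `Literature.Probability.RandomPlanarGeometry.SAW`; all proved, standard axioms)

* runs: `runLen`, `take_runLen_cons`, `getElem_runLen_ne`, `wturns_eq_runLen`, `exists_peel`, `peel_spec`, `rest1`, `rest4`,
  `runN`, `runD`, `runword`, **`four_runs`** (a word with `≥ 4` turns is `runword (runD w) (runN w) ++ rest4 w`, consecutive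
  run letters differ, `wturns w = wturns (rest4 w) + 4`), `eq_replicate_of_wturns_eq_zero`, `exists_runword0` (words with
  `≤ 3` turns are at-most-4-run words);
* letter symmetry: `wturns_map`, `rotL`, `IsSAW.map_rotL`, `headSum`, **`headSum_eq_quarter`** (each first-letter class of
  `sawWords M` carries exactly `Z_M(t)/4`, `M ≥ 1`), `sum_headSum`, `headSum_le_quarter`;
* geometry: `Step.vec_add_two`, `wEnd_replicate`, `traj_replicate`, `wturns_replicate`, `isSAW_replicate`, `one_le_Zbend`,
  **`IsSAW.ne_add_two`** (no reversal), **`not_isSAW_spiral`** (`d₀^{r₀}d₁^{r₁}(-d₀)^{r₂}(-d₁)^{r₃}` revisits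
  `(r₀-r₂)e_{d₀}` when `1 ≤ r₂ ≤ r₀`, `r₁ ≤ r₃`);
* the first block: `AdmKey` (consecutive run letters perpendicular, not the self-intersecting spiral),
  `IsSAW.admKey_runD_runN`, `highWords`, `admKeys`, `key_mem_admKeys`, `rest4_mem`, `rest4_injOn`, `fiber_sum_le`,
  `A4w` (`A₄ ∈ {6, 8}`), **`card_filter_admKey`** (`#{admissible letter chains} = 4·A₄(ℓ)`, by `decide`), `lowSum`, `nbox`,
  **`Zbend_le_lowSum_add`: `Z_N(t) ≤ Σ_{≤ 3 turns} t^{turns} + 2t⁴ Σ_{n ∈ nbox N} A₄(n) Z_{N-|n|-4}(t)`** (`t ≥ 0`),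
  and the low-part bound **`lowSum_le`**: `≤ max(1,t)³ · 4⁴ (N+1)⁴`.

The analytic half (`Σ_n A₄(n) x^{|n|+4} = B̂₄(x)`, summation of the inequality, `StiffUpper4_allt`, `StiffUpper4_asymp`)
is `SAWBendingEnergyUpper4.lean`.
-/


noncomputable section

open Finset Filter Topology
open scoped BigOperators
open Literature.Probability.LatticeModels

namespace Literature.Probability.RandomPlanarGeometry.SAW

/-! ### The first run of a word -/

/-- Length of the first maximal constant run of a word (`0` for the empty word). [cite: MadrasSlade1993, §1.1] -/
def runLen : List Step → ℕ
  | [] => 0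
  | [_] => 1
  | a :: b :: w => if a = b then runLen (b :: w) + 1 else 1

/-- `runLen [] = 0`. [cite: MadrasSlade1993, §1.1] -/
@[simp] theorem runLen_nil : runLen [] = 0 := rfl

/-- `runLen [a] = 1`. [cite: MadrasSlade1993, §1.1] -/
@[simp] theorem runLen_singleton (a : Step) : runLen [a] = 1 := rfl

/-- The recursion for `runLen`. [cite: MadrasSlade1993, §1.1] -/
theorem runLen_cons_cons (a b : Step) (w : List Step) :
    runLen (a :: b :: w) = if a = b then runLen (b :: w) + 1 else 1 := rfl

/-- `1 ≤ runLen (a :: v) ≤ |a :: v|`. [cite: MadrasSlade1993, §1.1] -/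
theorem one_le_runLen_cons (a : Step) (v : List Step) : 1 ≤ runLen (a :: v) ∧ runLen (a :: v) ≤ (a :: v).length := by
  induction v generalizing a with
  | nil => simp
  | cons b w ih =>
    rw [runLen_cons_cons]
    split_ifs with h
    · have := ih b; simp only [List.length_cons] at this ⊢; omega
    · simp

/-- The first run is constant: `(a :: v).take (runLen (a :: v)) = replicate (runLen (a :: v)) a`. [cite: MadrasSlade1993, §1.1] -/
theorem take_runLen_cons (a : Step) (v : List Step) :
    (a :: v).take (runLen (a :: v)) = List.replicate (runLen (a :: v)) a := by
  induction v generalizing a with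
  | nil => simp
  | cons b w ih =>
    rw [runLen_cons_cons]
    split_ifs with h
    · subst h
      rw [List.take_succ_cons, ih a, List.replicate_succ]
    · simp

/-- The letter right after the first run (if any) differs from the head. [cite: MadrasSlade1993, §1.1] -/
theorem getElem_runLen_ne (a : Step) (v : List Step) (h : runLen (a :: v) < (a :: v).length) :
    (a :: v)[runLen (a :: v)] ≠ a := by
  induction v generalizing a with
  | nil => simp at h
  | cons b w ih =>
    have hr : runLen (a :: b :: w) = if a = b then runLen (b :: w) + 1 else 1 := rfl
    by_cases hab : a = b
    · subst hab
      have h' : runLen (a :: w) < (a :: w).length := by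
        rw [hr, if_pos rfl] at h; simp only [List.length_cons] at h ⊢; omega
      have key := ih a h'
      simp only [hr]
      exact key
    · simp only [hr, if_neg hab, List.getElem_cons_succ, List.getElem_cons_zero]
      exact fun hba => hab hba.symm

/-- Turns and the first run: if the first run is not the whole word, peeling it removes exactly one turn;
otherwise there is no turn. [cite: MadrasSlade1993, §2.1] -/
theorem wturns_eq_runLen (a : Step) (v : List Step) :
    wturns (a :: v) = if runLen (a :: v) < (a :: v).length then wturns ((a :: v).drop (runLen (a :: v))) + 1 else 0 := by
  induction v generalizing a with
  | nil => simp
  | cons b w ih =>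
    have hr : runLen (a :: b :: w) = if a = b then runLen (b :: w) + 1 else 1 := rfl
    by_cases hab : a = b
    · subst hab
      rw [wturns_cons_cons, if_pos rfl, zero_add, ih a, hr, if_pos rfl]
      simp only [List.length_cons, List.drop_succ_cons]
      by_cases h : runLen (a :: w) < w.length + 1
      · rw [if_pos h, if_pos (by omega)]
      · rw [if_neg h, if_neg (by omega)]
    · rw [wturns_cons_cons, if_neg hab, hr, if_neg hab]
      simp [Nat.add_comm]

/-- **Peeling the first run**: a word with at least one turn is `replicate r a ++ w₁` with `r = runLen ≥ 1`, `w₁`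
nonempty with head `≠ a`, and `wturns = wturns w₁ + 1`. [cite: MadrasSlade1993, §2.1] -/
theorem exists_peel {w : List Step} (hw : 1 ≤ wturns w) :
    ∃ (a b : Step) (r : ℕ) (w₁ : List Step), 1 ≤ r ∧ a ≠ b ∧ w = List.replicate r a ++ (b :: w₁) ∧
      wturns w = wturns (b :: w₁) + 1 ∧ r + (b :: w₁).length = w.length := by
  match w, hw with
  | [], hw => simp at hw
  | a :: v, hw =>
    have hlt : runLen (a :: v) < (a :: v).length := by
      by_contra h
      rw [wturns_eq_runLen, if_neg h] at hw
      exact absurd hw (by norm_num)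
    set r := runLen (a :: v) with hr
    have hsplit : a :: v = (a :: v).take r ++ (a :: v).drop r := (List.take_append_drop r (a :: v)).symm
    have hdrop : (a :: v).drop r ≠ [] := by
      intro h
      have := List.drop_eq_nil_iff.1 h
      omega
    obtain ⟨b, w₁, hbw⟩ : ∃ b w₁, (a :: v).drop r = b :: w₁ := by
      cases hd : (a :: v).drop r with
      | nil => exact absurd hd hdrop
      | cons b w₁ => exact ⟨b, w₁, rfl⟩
    have hb : b ≠ a := by
      have h1 : ((a :: v).drop r)[0]'(by rw [hbw]; simp) = (a :: v)[r] := by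
        simp [List.getElem_drop]
      have h2 : ((a :: v).drop r)[0]'(by rw [hbw]; simp) = b := by simp [hbw]
      rw [← h2, h1]
      exact getElem_runLen_ne a v hlt
    refine ⟨a, b, r, w₁, (one_le_runLen_cons a v).1, fun h => hb h.symm, ?_, ?_, ?_⟩
    · rw [← hbw, ← take_runLen_cons a v]; exact hsplit
    · rw [wturns_eq_runLen, if_pos hlt, hbw]
    · have := List.length_drop (i := r) (l := a :: v)
      rw [hbw] at this
      simp only [List.length_cons] at this ⊢
      omega

/-- A word without turns is constant. [cite: MadrasSlade1993, §2.1] -/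
theorem eq_replicate_of_wturns_eq_zero {a : Step} {v : List Step} (h : wturns (a :: v) = 0) :
    a :: v = List.replicate (v.length + 1) a := by
  have hle := (one_le_runLen_cons a v).2
  have hnl : ¬ runLen (a :: v) < (a :: v).length := by
    intro hlt
    rw [wturns_eq_runLen, if_pos hlt] at h
    omega
  have heq : runLen (a :: v) = (a :: v).length := le_antisymm hle (not_lt.1 hnl)
  have := take_runLen_cons a v
  rw [heq, List.take_length] at this
  simpa using this

/-- The first run of `replicate r a ++ b :: v` (`r ≥ 1`, `b ≠ a`) has length exactly `r`. [cite: MadrasSlade1993, §1.1] -/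
theorem runLen_replicate_append {r : ℕ} (hr : 1 ≤ r) {a b : Step} (hab : b ≠ a) (v : List Step) :
    runLen (List.replicate r a ++ b :: v) = r := by
  induction r, hr using Nat.le_induction with
  | base => simp [List.replicate, runLen_cons_cons, Ne.symm hab]
  | succ r hr ih =>
    rw [List.replicate_succ, List.cons_append]
    obtain ⟨r', rfl⟩ : ∃ r', r = r' + 1 := ⟨r - 1, by omega⟩
    rw [List.replicate_succ, List.cons_append] at ih ⊢
    rw [runLen_cons_cons, if_pos rfl, ih]

/-! ### Letter symmetries: turn counts and self-avoidance are invariant, so the four head classes weigh the same -/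

/-- `wturns` is invariant under an injective relabelling of the alphabet. [cite: MadrasSlade1993, §1.1] -/
theorem wturns_map {g : Step → Step} (hg : Function.Injective g) : ∀ w : List Step, wturns (w.map g) = wturns w
  | [] => rfl
  | [a] => rfl
  | a :: b :: w => by
    have ih := wturns_map hg (b :: w)
    rw [List.map_cons] at ih
    simp only [List.map_cons, wturns_cons_cons, ih]
    by_cases h : a = b
    · simp [h]
    · simp [h, hg.ne h]

/-- The quarter turn `d ↦ d + 1` of the step alphabet (`+e₀ ↦ +e₁ ↦ -e₀ ↦ -e₁ ↦ +e₀`). [cite: MadrasSlade1993, §1.1] -/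
def rotL (d : Step) : Step := d + 1

/-- `rotL` is injective. [cite: MadrasSlade1993, §1.1] -/
theorem rotL_injective : Function.Injective rotL := fun a b h => by simpa [rotL] using h

/-- The quarter turn preserves self-avoidance (it is realised by the injective linear map `(x, y) ↦ (-y, x)`).
[cite: MadrasSlade1993, §1.1] -/
theorem IsSAW.map_rotL {w : List Step} (h : IsSAW w) : IsSAW (w.map rotL) := by
  refine isSAW_map_of_linear rotL rotNegYX ?_ (fun x y => ?_) (fun d => ?_) (fun x y hxy => ?_) h
  · ext i; fin_cases i
    · show -((0 : Site 2) 1) = 0; simp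
    · rfl
  · ext i; fin_cases i
    · show -((x + y) 1) = -(x 1) + -(y 1); simp only [Pi.add_apply]; ring
    · rfl
  · fin_cases d <;> decide
  · have h0 := congrFun hxy 0; have h1 := congrFun hxy 1
    simp only [rotNegYX, Matrix.cons_val_zero, Matrix.cons_val_one, neg_inj] at h0 h1
    ext i; fin_cases i; exacts [h1, h0]

/-- The turn-weighted sum over the self-avoiding words of length `M` with prescribed first letter `d`.
[cite: MadrasSlade1993, §2.1] -/
def headSum (M : ℕ) (t : ℝ) (d : Step) : ℝ :=
  ∑ w ∈ (sawWords M).filter (fun w => w.head? = some d), t ^ wturns w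

/-- `headSum ≥ 0` for `t ≥ 0`. [cite: MadrasSlade1993, §2.1] -/
theorem headSum_nonneg (M : ℕ) {t : ℝ} (ht : 0 ≤ t) (d : Step) : 0 ≤ headSum M t d :=
  Finset.sum_nonneg fun _ _ => by positivity

/-- Rotating the alphabet maps the head class `d` into the head class `d + 1` preserving weights, so
`headSum M t d ≤ headSum M t (d + 1)`. [cite: MadrasSlade1993, §1.1] -/
theorem headSum_le_headSum_rotL (M : ℕ) {t : ℝ} (ht : 0 ≤ t) (d : Step) : headSum M t d ≤ headSum M t (rotL d) := by
  classical
  unfold headSum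
  have hinj : Set.InjOn (fun w : List Step => w.map rotL) ((sawWords M).filter fun w => w.head? = some d) :=
    fun w _ w' _ h => List.map_injective_iff.2 rotL_injective h
  calc ∑ w ∈ (sawWords M).filter (fun w => w.head? = some d), t ^ wturns w
      = ∑ w ∈ (sawWords M).filter (fun w => w.head? = some d), t ^ wturns (w.map rotL) := by
        refine Finset.sum_congr rfl fun w _ => ?_; rw [wturns_map rotL_injective]
    _ = ∑ v ∈ ((sawWords M).filter (fun w => w.head? = some d)).image (fun w => w.map rotL), t ^ wturns v := by
        rw [Finset.sum_image hinj]
    _ ≤ ∑ v ∈ (sawWords M).filter (fun w => w.head? = some (rotL d)), t ^ wturns v := by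
        refine Finset.sum_le_sum_of_subset_of_nonneg (fun v hv => ?_) fun _ _ _ => by positivity
        rw [Finset.mem_image] at hv
        obtain ⟨w, hw, rfl⟩ := hv
        rw [Finset.mem_filter, mem_sawWords] at hw ⊢
        refine ⟨⟨by rw [List.length_map, hw.1.1], hw.1.2.map_rotL⟩, ?_⟩
        cases w with
        | nil => simp at hw
        | cons a v => simp only [List.map_cons, List.head?_cons, Option.some.injEq] at hw ⊢; rw [hw.2]

/-- **All four head classes weigh the same.** [cite: MadrasSlade1993, §1.1] -/
theorem headSum_eq_headSum (M : ℕ) {t : ℝ} (ht : 0 ≤ t) (d d' : Step) : headSum M t d = headSum M t d' := by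
  have h : ∀ e : Step, headSum M t e ≤ headSum M t (e + 1) := fun e => headSum_le_headSum_rotL M ht e
  have h0 : headSum M t 0 ≤ headSum M t 1 := by simpa using h 0
  have h1 : headSum M t 1 ≤ headSum M t 2 := by simpa using h 1
  have h2 : headSum M t 2 ≤ headSum M t 3 := by simpa using h 2
  have h3 : headSum M t 3 ≤ headSum M t 0 := by simpa using h 3
  have e1 : headSum M t 1 = headSum M t 0 := by linarith
  have e2 : headSum M t 2 = headSum M t 0 := by linarith
  have e3 : headSum M t 3 = headSum M t 0 := by linarith
  have hall : ∀ e : Step, headSum M t e = headSum M t 0 := by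
    intro e
    fin_cases e
    · rfl
    · exact e1
    · exact e2
    · exact e3
  rw [hall d, hall d']

/-- For `M ≥ 1` the head classes partition the self-avoiding words: `Σ_d headSum M t d = Z_M(t)`.
[cite: MadrasSlade1993, §1.1] -/
theorem sum_headSum (M : ℕ) (hM : 1 ≤ M) (t : ℝ) : ∑ d : Step, headSum M t d = Zd.Zbend M t := by
  classical
  rw [Zbend_eq_sum_sawWords]
  unfold headSum
  have key := Finset.sum_fiberwise_of_maps_to (s := sawWords M) (t := (Finset.univ : Finset (Option Step)))
    (g := fun w : List Step => w.head?) (fun _ _ => Finset.mem_univ _) (fun w => t ^ wturns w)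
  rw [Fintype.sum_option] at key
  have hnone : ∑ w ∈ (sawWords M).filter (fun w => w.head? = none), t ^ wturns w = 0 := by
    refine Finset.sum_eq_zero fun w hw => ?_
    rw [Finset.mem_filter, mem_sawWords, List.head?_eq_none_iff] at hw
    have := hw.1.1; rw [hw.2] at this; simp at this; omega
  rw [hnone, zero_add] at key
  exact key

/-- **Each head class carries a quarter of `Z_M(t)`** (`M ≥ 1`, `t ≥ 0`). [cite: MadrasSlade1993, §1.1] -/
theorem headSum_eq_quarter (M : ℕ) (hM : 1 ≤ M) {t : ℝ} (ht : 0 ≤ t) (d : Step) :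
    headSum M t d = Zd.Zbend M t / 4 := by
  have h := sum_headSum M hM t
  rw [Fin.sum_univ_four, headSum_eq_headSum M ht 1 d, headSum_eq_headSum M ht 2 d, headSum_eq_headSum M ht 3 d,
    headSum_eq_headSum M ht 0 d] at h
  linarith

/-! ### Geometry of runs: no reversals in a self-avoiding word; the 4-segment spiral -/

/-- The opposite letter `d + 2` has the opposite unit step. [cite: MadrasSlade1993, §1.1] -/
theorem Step.vec_add_two (d : Step) : Step.vec (d + 2) = -Step.vec d := by
  fin_cases d <;> decide

/-- Endpoint of a constant word: `wEnd (replicate r d) = r · e_d`. [cite: MadrasSlade1993, §1.1] -/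
theorem wEnd_replicate (r : ℕ) (d : Step) : wEnd (List.replicate r d) = (r : ℤ) • Step.vec d := by
  induction r with
  | zero => simp
  | succ r ih => rw [List.replicate_succ, wEnd_cons, ih]; push_cast; rw [add_smul, one_smul, add_comm]

/-- Along a constant word: `traj (replicate r d) i = i · e_d` for `i ≤ r`. [cite: MadrasSlade1993, §1.1] -/
theorem traj_replicate {r i : ℕ} (hi : i ≤ r) (d : Step) : traj (List.replicate r d) i = (i : ℤ) • Step.vec d := by
  rw [traj, List.take_replicate, min_eq_left hi, wEnd_replicate]

/-- A constant word has no turns. [cite: MadrasSlade1993, §2.1] -/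
theorem wturns_replicate (M : ℕ) (d : Step) : wturns (List.replicate M d) = 0 := by
  induction M with
  | zero => rfl
  | succ M ih =>
    cases M with
    | zero => rfl
    | succ M => rw [List.replicate_succ, List.replicate_succ, wturns_cons_cons, if_pos rfl, ← List.replicate_succ, ih]

/-- A constant word (a straight walk) is self-avoiding. [cite: MadrasSlade1993, §1.1] -/
theorem isSAW_replicate (M : ℕ) (d : Step) : IsSAW (List.replicate M d) := by
  rw [isSAW_iff_injOn]
  intro i hi j hj hij
  simp only [Set.mem_setOf_eq, List.length_replicate] at hi hj
  rw [traj_replicate hi, traj_replicate hj] at hij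
  have h := congrArg (fun v : Site 2 => v 0 * Step.dx d + v 1 * Step.dy d) hij
  simp only [Pi.smul_apply, Step.vec_apply_zero, Step.vec_apply_one, smul_eq_mul] at h
  have hd : Step.dx d * Step.dx d + Step.dy d * Step.dy d = 1 := by fin_cases d <;> simp [Step.dx, Step.dy]
  have : (i : ℤ) * (Step.dx d * Step.dx d + Step.dy d * Step.dy d) = (j : ℤ) * (Step.dx d * Step.dx d + Step.dy d * Step.dy d) := by
    linarith
  rw [hd, mul_one, mul_one] at this
  exact_mod_cast this

/-- **`Z_M(t) ≥ 1`** for `t ≥ 0`: the straight walk contributes `t⁰ = 1`. [cite: MadrasSlade1993, §2.1] -/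
theorem one_le_Zbend (M : ℕ) {t : ℝ} (ht : 0 ≤ t) : 1 ≤ Zd.Zbend M t := by
  classical
  rw [Zbend_eq_sum_sawWords]
  have hmem : List.replicate M (0 : Step) ∈ sawWords M := mem_sawWords.2 ⟨by simp, isSAW_replicate M 0⟩
  have h := Finset.single_le_sum (f := fun w => t ^ wturns w) (fun w _ => by positivity) hmem
  simpa [wturns_replicate] using h

/-- **No reversal**: in a self-avoiding word two consecutive letters are never opposite. [cite: MadrasSlade1993, §1.1] -/
theorem IsSAW.ne_add_two {u v : List Step} {a b : Step} (h : IsSAW (u ++ a :: b :: v)) : b ≠ a + 2 := by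
  intro hb
  rw [isSAW_iff_injOn] at h
  have h1 : traj (u ++ a :: b :: v) (u.length + 2) = traj (u ++ a :: b :: v) (u.length + 0) := by
    rw [traj_append_right, traj_append_right, traj_cons_two, traj_zero, hb, Step.vec_add_two]; simp
  have := h (by simp) (by simp) h1
  omega

/-- **The 4-segment spiral is not self-avoiding**: `d₀^{r₀} d₁^{r₁} (-d₀)^{r₂} (-d₁)^{r₃} …` with `1 ≤ r₂ ≤ r₀` and
`r₁ ≤ r₃` revisits the point `(r₀ - r₂)·e_{d₀}` of its first segment. [cite: MadrasSlade1993, §1.1] -/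
theorem not_isSAW_spiral {r₀ r₁ r₂ r₃ : ℕ} (h20 : r₂ ≤ r₀) (h13 : r₁ ≤ r₃) (h2 : 1 ≤ r₂) (d₀ d₁ : Step)
    (v : List Step) :
    ¬ IsSAW (List.replicate r₀ d₀ ++ (List.replicate r₁ d₁ ++ (List.replicate r₂ (d₀ + 2) ++
      (List.replicate r₃ (d₁ + 2) ++ v)))) := by
  intro h
  rw [isSAW_iff_injOn] at h
  set w := List.replicate r₀ d₀ ++ (List.replicate r₁ d₁ ++ (List.replicate r₂ (d₀ + 2) ++
      (List.replicate r₃ (d₁ + 2) ++ v))) with hw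
  -- the two colliding times
  have hA : traj w (r₀ - r₂) = ((r₀ - r₂ : ℕ) : ℤ) • Step.vec d₀ := by
    rw [hw, traj_append_left _ _ (by simp only [List.length_replicate]; omega), traj_replicate (by omega)]
  have hB : traj w (r₀ + (r₁ + (r₂ + r₁))) = ((r₀ - r₂ : ℕ) : ℤ) • Step.vec d₀ := by
    have i0 : r₀ + (r₁ + (r₂ + r₁)) = (List.replicate r₀ d₀).length + (r₁ + (r₂ + r₁)) := by simp
    have i1 : r₁ + (r₂ + r₁) = (List.replicate r₁ d₁).length + (r₂ + r₁) := by simp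
    have i2 : r₂ + r₁ = (List.replicate r₂ (d₀ + 2)).length + r₁ := by simp
    rw [hw, i0, traj_append_right, i1, traj_append_right, i2, traj_append_right,
      traj_append_left _ _ (by simp only [List.length_replicate]; omega), traj_replicate h13, wEnd_replicate,
      wEnd_replicate, wEnd_replicate, Step.vec_add_two, Step.vec_add_two]
    simp only [smul_neg]
    push_cast [Nat.cast_sub h20]
    module
  have hlen : r₀ + (r₁ + (r₂ + r₁)) ≤ w.length := by
    simp only [hw, List.length_append, List.length_replicate]; omega
  have := h (show r₀ - r₂ ≤ w.length by omega) hlen (hA.trans hB.symm)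
  omega

/-! ### Peeling runs as functions -/

/-- The word after its first run. [cite: MadrasSlade1993, §1.1] -/
def rest1 (w : List Step) : List Step := w.drop (runLen w)

/-- **Peeling the first run, functional form**: for a word with a turn, `w = replicate (runLen w) (head) ++ rest1 w`,
`rest1 w` is nonempty with a different head, one turn is removed, lengths add up. [cite: MadrasSlade1993, §2.1] -/
theorem peel_spec {w : List Step} (hw : 1 ≤ wturns w) :
    w = List.replicate (runLen w) (w.headD 0) ++ rest1 w ∧ rest1 w ≠ [] ∧ (rest1 w).headD 0 ≠ w.headD 0 ∧
      wturns w = wturns (rest1 w) + 1 ∧ 1 ≤ runLen w ∧ runLen w + (rest1 w).length = w.length := by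
  match w, hw with
  | [], hw => simp at hw
  | a :: v, hw =>
    have hlt : runLen (a :: v) < (a :: v).length := by
      by_contra h
      rw [wturns_eq_runLen, if_neg h] at hw
      exact absurd hw (by norm_num)
    have hne : rest1 (a :: v) ≠ [] := by
      intro h
      have := List.drop_eq_nil_iff.1 h
      exact absurd this (by simpa [rest1] using hlt)
    obtain ⟨b, w₁, hbw⟩ : ∃ b w₁, rest1 (a :: v) = b :: w₁ := by
      cases hd : rest1 (a :: v) with
      | nil => exact absurd hd hne
      | cons b w₁ => exact ⟨b, w₁, rfl⟩
    have hb : b ≠ a := by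
      have h1 : (rest1 (a :: v))[0]'(by rw [hbw]; simp) = (a :: v)[runLen (a :: v)] := by
        simp [rest1, List.getElem_drop]
      have h2 : (rest1 (a :: v))[0]'(by rw [hbw]; simp) = b := by simp [hbw]
      rw [← h2, h1]
      exact getElem_runLen_ne a v hlt
    refine ⟨?_, hne, ?_, ?_, (one_le_runLen_cons a v).1, ?_⟩
    · conv_lhs => rw [← List.take_append_drop (runLen (a :: v)) (a :: v)]
      rw [take_runLen_cons]; rfl
    · rw [hbw]; simpa using hb
    · rw [wturns_eq_runLen, if_pos hlt]; rfl
    · have h1 : (rest1 (a :: v)).length = (a :: v).length - runLen (a :: v) := by simp [rest1]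
      have h2 := (one_le_runLen_cons a v).2
      omega

/-- The word after its first four runs, and the run data. [cite: MadrasSlade1993, §2.1] -/
def rest4 (w : List Step) : List Step := rest1 (rest1 (rest1 (rest1 w)))

/-- The four run lengths minus one. [cite: MadrasSlade1993, §2.1] -/
def runN (w : List Step) : Fin 4 → ℕ :=
  ![runLen w - 1, runLen (rest1 w) - 1, runLen (rest1 (rest1 w)) - 1, runLen (rest1 (rest1 (rest1 w))) - 1]

/-- The four run letters. [cite: MadrasSlade1993, §2.1] -/
def runD (w : List Step) : Fin 4 → Step :=
  ![w.headD 0, (rest1 w).headD 0, (rest1 (rest1 w)).headD 0, (rest1 (rest1 (rest1 w))).headD 0]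

/-- The 4-run word with letters `d` and run lengths `n + 1`. [cite: MadrasSlade1993, §2.1] -/
def runword (d : Fin 4 → Step) (n : Fin 4 → ℕ) : List Step :=
  List.replicate (n 0 + 1) (d 0) ++ (List.replicate (n 1 + 1) (d 1) ++ (List.replicate (n 2 + 1) (d 2) ++
    List.replicate (n 3 + 1) (d 3)))

/-- Length of the 4-run word. [cite: MadrasSlade1993, §2.1] -/
theorem length_runword (d : Fin 4 → Step) (n : Fin 4 → ℕ) :
    (runword d n).length = n 0 + n 1 + n 2 + n 3 + 4 := by
  simp [runword]; ring

/-- **The first four runs of a word with at least four turns**: `w = runword (runD w) (runN w) ++ rest4 w`, consecutive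
run letters differ, `rest4 w` is nonempty with head different from the fourth run letter, and
`wturns w = wturns (rest4 w) + 4`. [cite: MadrasSlade1993, §2.1] -/
theorem four_runs {w : List Step} (hw : 4 ≤ wturns w) :
    w = runword (runD w) (runN w) ++ rest4 w ∧ rest4 w ≠ [] ∧ (rest4 w).headD 0 ≠ runD w 3 ∧
      (∀ i : Fin 3, runD w i.succ ≠ runD w i.castSucc) ∧ wturns w = wturns (rest4 w) + 4 ∧
      (runword (runD w) (runN w)).length + (rest4 w).length = w.length := by
  obtain ⟨e0, -, hd0, t0, r0, l0⟩ := peel_spec (w := w) (by omega)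
  obtain ⟨e1, -, hd1, t1, r1, l1⟩ := peel_spec (w := rest1 w) (by omega)
  obtain ⟨e2, -, hd2, t2, r2, l2⟩ := peel_spec (w := rest1 (rest1 w)) (by omega)
  obtain ⟨e3, ne3, hd3, t3, r3, l3⟩ := peel_spec (w := rest1 (rest1 (rest1 w))) (by omega)
  have hrw : runword (runD w) (runN w) = List.replicate (runLen w) (w.headD 0) ++
      (List.replicate (runLen (rest1 w)) ((rest1 w).headD 0) ++
      (List.replicate (runLen (rest1 (rest1 w))) ((rest1 (rest1 w)).headD 0) ++
      List.replicate (runLen (rest1 (rest1 (rest1 w)))) ((rest1 (rest1 (rest1 w))).headD 0))) := by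
    simp only [runword, runD, runN, Matrix.cons_val_zero, Matrix.cons_val_one, Matrix.cons_val]
    rw [Nat.sub_add_cancel r0, Nat.sub_add_cancel r1, Nat.sub_add_cancel r2, Nat.sub_add_cancel r3]
  refine ⟨?_, ne3, ?_, ?_, by simp only [rest4]; omega, ?_⟩
  · rw [hrw, rest4]
    simp only [List.append_assoc]
    conv_lhs => rw [e0, e1, e2, e3]
  · simpa [runD, rest4] using hd3
  · intro i
    fin_cases i
    · simpa [runD] using hd0
    · simpa [runD] using hd1
    · simpa [runD] using hd2
  · rw [hrw, rest4]
    simp only [List.length_append, List.length_replicate]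
    omega

/-! ### Self-avoiding words with at least four turns: admissible first-block data -/

/-- Consecutive runs of a self-avoiding word are never opposite: if `w = u ++ a^{n+1} ++ b^{m+1} ++ v` is self-avoiding
then `b ≠ -a`. [cite: MadrasSlade1993, §1.1] -/
theorem IsSAW.ne_add_two_of_runs {u v : List Step} {a b : Step} {n m : ℕ}
    (h : IsSAW (u ++ (List.replicate (n + 1) a ++ (List.replicate (m + 1) b ++ v)))) : b ≠ a + 2 := by
  have e : u ++ (List.replicate (n + 1) a ++ (List.replicate (m + 1) b ++ v)) =
      (u ++ List.replicate n a) ++ a :: b :: (List.replicate m b ++ v) := by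
    rw [List.replicate_succ', List.replicate_succ]; simp
  rw [e] at h
  exact h.ne_add_two

/-- Two letters of `Fin 4` that are neither equal nor opposite differ by a quarter turn. [cite: MadrasSlade1993, §1.1] -/
theorem Step.eq_add_one_or_eq_add_three {a b : Step} (h1 : b ≠ a) (h2 : b ≠ a + 2) : b = a + 1 ∨ b = a + 3 := by
  revert a b; decide

/-- **Admissible first-block data**: consecutive run letters perpendicular, and not the self-intersecting spiral
(`d₂ = -d₀`, `d₃ = -d₁`, `ℓ₂ ≤ ℓ₀`, `ℓ₁ ≤ ℓ₃`). [cite: MadrasSlade1993, §2.1] -/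
def AdmKey (d : Fin 4 → Step) (n : Fin 4 → ℕ) : Prop :=
  (∀ i : Fin 3, d i.succ ≠ d i.castSucc ∧ d i.succ ≠ d i.castSucc + 2) ∧
    ¬ (d 2 = d 0 + 2 ∧ d 3 = d 1 + 2 ∧ n 2 ≤ n 0 ∧ n 1 ≤ n 3)

/-- `AdmKey` is decidable. [cite: MadrasSlade1993, §2.1] -/
instance (d : Fin 4 → Step) (n : Fin 4 → ℕ) : Decidable (AdmKey d n) := by
  unfold AdmKey; infer_instance

/-- For a self-avoiding word with at least four turns, the first-block data are admissible, and the remainder starts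
with a letter perpendicular to the fourth run. [cite: MadrasSlade1993, §2.1] -/
theorem IsSAW.admKey_runD_runN {w : List Step} (hs : IsSAW w) (hw : 4 ≤ wturns w) :
    AdmKey (runD w) (runN w) ∧
      ((rest4 w).headD 0 = runD w 3 + 1 ∨ (rest4 w).headD 0 = runD w 3 + 3) := by
  obtain ⟨hdec, hne, hhd, hdiff, -, -⟩ := four_runs hw
  set d := runD w
  set n := runN w
  set v := rest4 w
  have hw0 : w = List.replicate (n 0 + 1) (d 0) ++ (List.replicate (n 1 + 1) (d 1) ++
      (List.replicate (n 2 + 1) (d 2) ++ (List.replicate (n 3 + 1) (d 3) ++ v))) := by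
    rw [hdec, runword]; simp only [List.append_assoc]
  -- no reversals at the three internal junctions and at the exit
  have h01 : d 1 ≠ d 0 + 2 := by
    have h := hs; rw [hw0, ← List.nil_append (List.replicate (n 0 + 1) (d 0) ++ _)] at h
    exact h.ne_add_two_of_runs
  have h12 : d 2 ≠ d 1 + 2 := by
    have h := hs; rw [hw0] at h
    exact h.ne_add_two_of_runs
  have h23 : d 3 ≠ d 2 + 2 := by
    have h := hs; rw [hw0, ← List.append_assoc] at h
    exact h.ne_add_two_of_runs
  obtain ⟨b, v', hbv⟩ : ∃ b v', v = b :: v' := by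
    cases hv : v with
    | nil => exact absurd hv hne
    | cons b v' => exact ⟨b, v', rfl⟩
  have h3b : b ≠ d 3 + 2 := by
    have h := hs
    rw [hw0, hbv, ← List.append_assoc, ← List.append_assoc, show b :: v' = List.replicate (0 + 1) b ++ v' by simp] at h
    exact h.ne_add_two_of_runs
  have hb3 : b ≠ d 3 := by rw [hbv] at hhd; simpa using hhd
  refine ⟨⟨fun i => ?_, fun hbad => ?_⟩, ?_⟩
  · fin_cases i
    · exact ⟨hdiff 0, h01⟩
    · exact ⟨hdiff 1, h12⟩
    · exact ⟨hdiff 2, h23⟩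
  · obtain ⟨e2, e3, h20, h13⟩ := hbad
    have h := hs
    rw [hw0, e2, e3] at h
    exact not_isSAW_spiral (by omega) (by omega) (by omega) (d 0) (d 1) v h
  · rw [hbv]
    simpa using Step.eq_add_one_or_eq_add_three hb3 h3b

/-! ### The first-block renewal inequality -/

/-- The self-avoiding words of length `N` with at least four turns. [cite: MadrasSlade1993, §2.1] -/
def highWords (N : ℕ) : Finset (List Step) := (sawWords N).filter fun w => 4 ≤ wturns w

/-- Total of the run excesses `n₀ + n₁ + n₂ + n₃`. [cite: MadrasSlade1993, §2.1] -/
def nsum (n : Fin 4 → ℕ) : ℕ := n 0 + n 1 + n 2 + n 3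

/-- The admissible first-block keys for words of length `N`. [cite: MadrasSlade1993, §2.1] -/
def admKeys (N : ℕ) : Finset ((Fin 4 → Step) × (Fin 4 → ℕ)) :=
  ((Finset.univ : Finset (Fin 4 → Step)) ×ˢ Fintype.piFinset fun _ : Fin 4 => Finset.range N).filter
    fun κ => AdmKey κ.1 κ.2 ∧ nsum κ.2 + 4 ≤ N

/-- The key of a word with at least four turns lies in `admKeys N`. [cite: MadrasSlade1993, §2.1] -/
theorem key_mem_admKeys {N : ℕ} {w : List Step} (hw : w ∈ highWords N) : (runD w, runN w) ∈ admKeys N := by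
  rw [highWords, Finset.mem_filter, mem_sawWords] at hw
  obtain ⟨⟨hlen, hsaw⟩, h4⟩ := hw
  obtain ⟨hadm, -⟩ := hsaw.admKey_runD_runN h4
  obtain ⟨-, -, -, -, -, hl⟩ := four_runs h4
  rw [length_runword, hlen] at hl
  rw [admKeys, Finset.mem_filter, Finset.mem_product, Fintype.mem_piFinset]
  refine ⟨⟨Finset.mem_univ _, fun i => Finset.mem_range.2 ?_⟩, hadm, ?_⟩
  · fin_cases i <;> simp <;> omega
  · show nsum (runN w) + 4 ≤ N
    rw [nsum]; omega

/-- The remainder of a word of `highWords N` with key `κ` is a self-avoiding word of length `N - |κ| - 4` starting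
perpendicular to the fourth run. [cite: MadrasSlade1993, §2.1] -/
theorem rest4_mem {N : ℕ} {w : List Step} (hw : w ∈ highWords N) :
    rest4 w ∈ ((sawWords (N - (nsum (runN w) + 4))).filter fun v => v.head? = some (runD w 3 + 1)) ∪
      ((sawWords (N - (nsum (runN w) + 4))).filter fun v => v.head? = some (runD w 3 + 3)) := by
  rw [highWords, Finset.mem_filter, mem_sawWords] at hw
  obtain ⟨⟨hlen, hsaw⟩, h4⟩ := hw
  obtain ⟨-, hperp⟩ := hsaw.admKey_runD_runN h4
  obtain ⟨hdec, hne, -, -, -, hl⟩ := four_runs h4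
  rw [length_runword, hlen] at hl
  have hs4 : IsSAW (rest4 w) := by
    simp only [rest4, rest1]
    exact (((hsaw.drop _).drop _).drop _).drop _
  have hl4 : (rest4 w).length = N - (nsum (runN w) + 4) := by rw [nsum]; omega
  obtain ⟨b, v', hbv⟩ : ∃ b v', rest4 w = b :: v' := by
    cases hv : rest4 w with
    | nil => exact absurd hv hne
    | cons b v' => exact ⟨b, v', rfl⟩
  rw [hbv] at hperp hs4 hl4 ⊢
  simp only [List.headD_cons] at hperp
  rw [Finset.mem_union, Finset.mem_filter, Finset.mem_filter, mem_sawWords]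
  rcases hperp with h | h
  · exact Or.inl ⟨⟨hl4, hs4⟩, by simp [h]⟩
  · exact Or.inr ⟨⟨hl4, hs4⟩, by simp [h]⟩

/-- `rest4` is injective on a key fiber. [cite: MadrasSlade1993, §2.1] -/
theorem rest4_injOn {N : ℕ} (κ : (Fin 4 → Step) × (Fin 4 → ℕ)) :
    Set.InjOn rest4 ((highWords N).filter fun w => (runD w, runN w) = κ) := by
  intro w hw w' hw' h
  rw [Finset.coe_filter, Set.mem_setOf_eq, highWords, Finset.mem_filter] at hw hw'
  obtain ⟨⟨-, h4⟩, hk⟩ := hw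
  obtain ⟨⟨-, h4'⟩, hk'⟩ := hw'
  have e := hk.trans hk'.symm
  rw [Prod.mk.injEq] at e
  obtain ⟨e1, e2⟩ := e
  rw [(four_runs h4).1, (four_runs h4').1, h, e1, e2]

/-- `headSum M t d ≤ Z_M(t)/4` for every `M` (equality for `M ≥ 1`; the class is empty for `M = 0`).
[cite: MadrasSlade1993, §1.1] -/
theorem headSum_le_quarter (M : ℕ) {t : ℝ} (ht : 0 ≤ t) (d : Step) : headSum M t d ≤ Zd.Zbend M t / 4 := by
  rcases Nat.eq_zero_or_pos M with rfl | hM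
  · have h0 : headSum 0 t d = 0 := by
      unfold headSum
      refine Finset.sum_eq_zero fun w hw => ?_
      rw [Finset.mem_filter, mem_sawWords, List.length_eq_zero_iff] at hw
      obtain ⟨⟨rfl, -⟩, h⟩ := hw
      simp at h
    rw [h0, Zbend_eq_sum_sawWords]
    have : 0 ≤ ∑ w ∈ sawWords 0, t ^ wturns w := Finset.sum_nonneg fun _ _ => by positivity
    linarith
  · rw [headSum_eq_quarter M hM ht d]

/-- The fiber sum over a key is at most half of `Z_{N-|κ|-4}(t)`. [cite: MadrasSlade1993, §2.1] -/
theorem fiber_sum_le {N : ℕ} {t : ℝ} (ht : 0 ≤ t) (κ : (Fin 4 → Step) × (Fin 4 → ℕ)) :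
    ∑ w ∈ (highWords N).filter (fun w => (runD w, runN w) = κ), t ^ wturns (rest4 w)
      ≤ Zd.Zbend (N - (nsum κ.2 + 4)) t / 2 := by
  classical
  set M := N - (nsum κ.2 + 4)
  set fiber := (highWords N).filter (fun w => (runD w, runN w) = κ)
  set A := (sawWords M).filter fun v => v.head? = some (κ.1 3 + 1)
  set B := (sawWords M).filter fun v => v.head? = some (κ.1 3 + 3)
  have hsub : fiber.image rest4 ⊆ A ∪ B := by
    intro v hv
    rw [Finset.mem_image] at hv
    obtain ⟨w, hw, rfl⟩ := hv
    rw [Finset.mem_filter] at hw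
    obtain ⟨hwH, hk⟩ := hw
    have h := rest4_mem hwH
    have e1 : runD w = κ.1 := (Prod.mk.inj hk).1
    have e2 : runN w = κ.2 := (Prod.mk.inj hk).2
    rwa [e1, e2] at h
  have hdisj : Disjoint A B := by
    rw [Finset.disjoint_filter]
    intro v _ h1 h2
    rw [h1, Option.some.injEq] at h2
    revert h2; generalize κ.1 3 = e; revert e; decide
  calc ∑ w ∈ fiber, t ^ wturns (rest4 w)
      = ∑ v ∈ fiber.image rest4, t ^ wturns v := by rw [Finset.sum_image (rest4_injOn κ)]
    _ ≤ ∑ v ∈ A ∪ B, t ^ wturns v :=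
        Finset.sum_le_sum_of_subset_of_nonneg hsub fun _ _ _ => by positivity
    _ = headSum M t (κ.1 3 + 1) + headSum M t (κ.1 3 + 3) := by rw [Finset.sum_union hdisj]; rfl
    _ ≤ Zd.Zbend M t / 4 + Zd.Zbend M t / 4 := add_le_add (headSum_le_quarter M ht _) (headSum_le_quarter M ht _)
    _ = Zd.Zbend M t / 2 := by ring

/-- The block weight `A₄(ℓ) ∈ {6, 8}` (number of admissible turn patterns out of `8`, with `ℓᵢ = nᵢ + 1`):
`6` exactly when the spiral with these lengths self-intersects (`ℓ₂ ≤ ℓ₀`, `ℓ₁ ≤ ℓ₃`). [cite: MadrasSlade1993, §2.1] -/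
def A4w (n : Fin 4 → ℕ) : ℝ := if n 2 ≤ n 0 ∧ n 1 ≤ n 3 then 6 else 8

/-- `A₄ ≥ 0`. [cite: MadrasSlade1993, §2.1] -/
theorem A4w_nonneg (n : Fin 4 → ℕ) : 0 ≤ A4w n := by unfold A4w; split_ifs <;> norm_num

/-- `A₄ ≤ 8`. [cite: MadrasSlade1993, §2.1] -/
theorem A4w_le_eight (n : Fin 4 → ℕ) : A4w n ≤ 8 := by unfold A4w; split_ifs <;> norm_num

/-- **Counting admissible letter chains**: `4 · A₄(ℓ)` (four first letters, two choices at each junction, minus the two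
spirals when they self-intersect). [cite: MadrasSlade1993, §2.1] -/
theorem card_filter_admKey (n : Fin 4 → ℕ) :
    ((((Finset.univ : Finset (Fin 4 → Step)).filter fun d => AdmKey d n).card : ℕ) : ℝ) = 4 * A4w n := by
  unfold A4w
  by_cases hc : n 2 ≤ n 0 ∧ n 1 ≤ n 3
  · have hset : ((Finset.univ : Finset (Fin 4 → Step)).filter fun d => AdmKey d n) =
        (Finset.univ : Finset (Fin 4 → Step)).filter fun d =>
          (∀ i : Fin 3, d i.succ ≠ d i.castSucc ∧ d i.succ ≠ d i.castSucc + 2) ∧ ¬ (d 2 = d 0 + 2 ∧ d 3 = d 1 + 2) :=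
      Finset.filter_congr fun d _ => by simp only [AdmKey, hc.1, hc.2, and_true]
    have h24 : ((Finset.univ : Finset (Fin 4 → Step)).filter fun d =>
        (∀ i : Fin 3, d i.succ ≠ d i.castSucc ∧ d i.succ ≠ d i.castSucc + 2) ∧ ¬ (d 2 = d 0 + 2 ∧ d 3 = d 1 + 2)).card
        = 24 := by decide
    rw [if_pos hc, hset, h24]; norm_num
  · have hset : ((Finset.univ : Finset (Fin 4 → Step)).filter fun d => AdmKey d n) =
        (Finset.univ : Finset (Fin 4 → Step)).filter fun d =>
          (∀ i : Fin 3, d i.succ ≠ d i.castSucc ∧ d i.succ ≠ d i.castSucc + 2) :=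
      Finset.filter_congr fun d _ => by simp only [AdmKey, hc, and_false, not_false_eq_true, and_true]
    have h32 : ((Finset.univ : Finset (Fin 4 → Step)).filter fun d =>
        (∀ i : Fin 3, d i.succ ≠ d i.castSucc ∧ d i.succ ≠ d i.castSucc + 2)).card = 32 := by decide
    rw [if_neg hc, hset, h32]; norm_num

/-- The low part: words with at most three turns. [cite: MadrasSlade1993, §2.1] -/
def lowSum (N : ℕ) (t : ℝ) : ℝ := ∑ w ∈ (sawWords N).filter (fun w => wturns w ≤ 3), t ^ wturns w

/-- The box of run excesses for words of length `N`. [cite: MadrasSlade1993, §2.1] -/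
def nbox (N : ℕ) : Finset (Fin 4 → ℕ) :=
  (Fintype.piFinset fun _ : Fin 4 => Finset.range N).filter fun n => nsum n + 4 ≤ N

/-- **The first-block renewal inequality** (4-segment blocks):
`Z_N(t) ≤ Σ_{≤ 3 turns} t^{turns} + 2t⁴ Σ_{ℓ ∈ ℕ_{≥1}^4, |ℓ| ≤ N} A₄(ℓ) Z_{N-|ℓ|}(t)`, for `t ≥ 0`.
[cite: MadrasSlade1993, §2.1] -/
theorem Zbend_le_lowSum_add {t : ℝ} (ht : 0 ≤ t) (N : ℕ) :
    Zd.Zbend N t ≤ lowSum N t + 2 * t ^ 4 * ∑ n ∈ nbox N, A4w n * Zd.Zbend (N - (nsum n + 4)) t := by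
  classical
  rw [Zbend_eq_sum_sawWords, ← Finset.sum_filter_add_sum_filter_not (sawWords N) (fun w => wturns w ≤ 3)]
  refine add_le_add (le_of_eq rfl) ?_
  have hH : (sawWords N).filter (fun w => ¬ wturns w ≤ 3) = highWords N := by
    unfold highWords
    exact Finset.filter_congr fun w _ => by omega
  rw [hH]
  have h1 : ∑ w ∈ highWords N, t ^ wturns w = t ^ 4 * ∑ w ∈ highWords N, t ^ wturns (rest4 w) := by
    rw [Finset.mul_sum]
    refine Finset.sum_congr rfl fun w hw => ?_
    rw [highWords, Finset.mem_filter] at hw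
    rw [(four_runs hw.2).2.2.2.2.1, pow_add, mul_comm]
  have h2 : ∑ w ∈ highWords N, t ^ wturns (rest4 w)
      = ∑ κ ∈ admKeys N, ∑ w ∈ (highWords N).filter (fun w => (runD w, runN w) = κ), t ^ wturns (rest4 w) :=
    (Finset.sum_fiberwise_of_maps_to (fun w hw => key_mem_admKeys hw) _).symm
  have h3 : ∑ κ ∈ admKeys N, ∑ w ∈ (highWords N).filter (fun w => (runD w, runN w) = κ), t ^ wturns (rest4 w)
      ≤ ∑ κ ∈ admKeys N, Zd.Zbend (N - (nsum κ.2 + 4)) t / 2 :=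
    Finset.sum_le_sum fun κ _ => fiber_sum_le ht κ
  have h4 : ∑ κ ∈ admKeys N, Zd.Zbend (N - (nsum κ.2 + 4)) t / 2
      = ∑ n ∈ nbox N, 4 * A4w n * (Zd.Zbend (N - (nsum n + 4)) t / 2) := by
    unfold admKeys nbox
    rw [Finset.sum_filter, Finset.sum_product_right, Finset.sum_filter]
    refine Finset.sum_congr rfl fun n _ => ?_
    by_cases hn : nsum n + 4 ≤ N
    · simp only [hn, and_true, if_true]
      rw [← Finset.sum_filter, Finset.sum_const, nsmul_eq_mul, card_filter_admKey]
    · simp [hn]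
  rw [h1, h2]
  calc t ^ 4 * ∑ κ ∈ admKeys N, ∑ w ∈ (highWords N).filter (fun w => (runD w, runN w) = κ), t ^ wturns (rest4 w)
      ≤ t ^ 4 * ∑ κ ∈ admKeys N, Zd.Zbend (N - (nsum κ.2 + 4)) t / 2 :=
        mul_le_mul_of_nonneg_left h3 (by positivity)
    _ = t ^ 4 * ∑ n ∈ nbox N, 4 * A4w n * (Zd.Zbend (N - (nsum n + 4)) t / 2) := by rw [h4]
    _ = 2 * t ^ 4 * ∑ n ∈ nbox N, A4w n * Zd.Zbend (N - (nsum n + 4)) t := by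
        rw [Finset.mul_sum, Finset.mul_sum]
        refine Finset.sum_congr rfl fun n _ => by ring

/-! ### Words with at most three turns: a polynomial bound for the low part -/

/-- The at-most-4-run word with letters `d` and run lengths `r` (zero lengths allowed). [cite: MadrasSlade1993, §2.1] -/
def runword0 (d : Fin 4 → Step) (r : Fin 4 → ℕ) : List Step :=
  List.replicate (r 0) (d 0) ++ (List.replicate (r 1) (d 1) ++ (List.replicate (r 2) (d 2) ++ List.replicate (r 3) (d 3)))

/-- **A word with `k ≤ 3` turns is an at-most-4-run word** using only the first `k + 1` slots.
[cite: MadrasSlade1993, §2.1] -/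
theorem exists_runword0 : ∀ (k : ℕ) (w : List Step), wturns w = k → k ≤ 3 →
    ∃ (d : Fin 4 → Step) (r : Fin 4 → ℕ), (∀ i, r i ≤ w.length) ∧ (∀ i : Fin 4, k < i.val → r i = 0) ∧
      w = runword0 d r
  | 0, w, hw, _ => by
    cases w with
    | nil => exact ⟨fun _ => 0, fun _ => 0, fun _ => le_rfl, fun _ _ => rfl, by simp [runword0]⟩
    | cons a v =>
      refine ⟨fun _ => a, ![v.length + 1, 0, 0, 0], fun i => ?_, fun i hi => ?_, ?_⟩
      · fin_cases i <;> simp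
      · fin_cases i
        · simp at hi
        · simp
        · simp
        · simp
      · simp only [runword0, Matrix.cons_val_zero, Matrix.cons_val_one, Matrix.cons_val]
        simpa using eq_replicate_of_wturns_eq_zero hw
  | k + 1, w, hw, hk => by
    obtain ⟨hdec, -, -, ht, -, hl⟩ := peel_spec (w := w) (by omega)
    obtain ⟨d', r', hr', hz', hw'⟩ := exists_runword0 k (rest1 w) (by omega) (by omega)
    have h3 : r' 3 = 0 := hz' 3 (by simp; omega)
    refine ⟨![w.headD 0, d' 0, d' 1, d' 2], ![runLen w, r' 0, r' 1, r' 2], fun i => ?_, fun i hi => ?_, ?_⟩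
    · fin_cases i
      · simp; omega
      · simpa using (hr' 0).trans (by omega)
      · simpa using (hr' 1).trans (by omega)
      · simpa using (hr' 2).trans (by omega)
    · fin_cases i
      · simp at hi
      · simp at hi
      · simp only [Fin.reduceFinMk, Matrix.cons_val] at hi ⊢
        exact hz' 1 (by simp; omega)
      · simp only [Fin.reduceFinMk, Matrix.cons_val] at hi ⊢
        exact hz' 2 (by simp; omega)
    · conv_lhs => rw [hdec, hw']
      simp [runword0, h3]

/-- **Polynomial bound for the low part**: there are at most `4⁴ (N+1)⁴` words of length `N` with at most three turns,
each weighing at most `max(1,t)³`. [cite: MadrasSlade1993, §2.1] -/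
theorem lowSum_le {t : ℝ} (ht : 0 ≤ t) (N : ℕ) : lowSum N t ≤ max 1 t ^ 3 * (4 ^ 4 * ((N : ℝ) + 1) ^ 4) := by
  classical
  unfold lowSum
  set F := (sawWords N).filter (fun w => wturns w ≤ 3) with hF
  set dom := (Finset.univ : Finset (Fin 4 → Step)) ×ˢ Fintype.piFinset fun _ : Fin 4 => Finset.range (N + 1)
  have hm1 : 1 ≤ max 1 t := le_max_left 1 t
  -- each term ≤ max(1,t)^3
  have hterm : ∀ w ∈ F, t ^ wturns w ≤ max 1 t ^ 3 := by
    intro w hw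
    rw [hF, Finset.mem_filter] at hw
    calc t ^ wturns w ≤ max 1 t ^ wturns w := pow_le_pow_left₀ ht (le_max_right 1 t) _
      _ ≤ max 1 t ^ 3 := pow_le_pow_right₀ hm1 hw.2
  -- F ⊆ image of runword0 over dom
  have hsub : F ⊆ dom.image (fun p => runword0 p.1 p.2) := by
    intro w hw
    rw [hF, Finset.mem_filter, mem_sawWords] at hw
    obtain ⟨⟨hlen, -⟩, hk⟩ := hw
    obtain ⟨d, r, hr, -, hw⟩ := exists_runword0 (wturns w) w rfl hk
    rw [Finset.mem_image]
    refine ⟨(d, r), ?_, hw.symm⟩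
    rw [Finset.mem_product, Fintype.mem_piFinset]
    refine ⟨Finset.mem_univ _, fun i => Finset.mem_range.2 ?_⟩
    have := hr i
    rw [hlen] at this
    exact Nat.lt_succ_of_le this
  have hcard : (F.card : ℝ) ≤ 4 ^ 4 * ((N : ℝ) + 1) ^ 4 := by
    have h1 := (Finset.card_le_card hsub).trans Finset.card_image_le
    have h2 : dom.card = 4 ^ 4 * (N + 1) ^ 4 := by
      simp [dom, Finset.card_product, Fintype.card_piFinset, Finset.card_range, Finset.prod_const]
    have : (F.card : ℝ) ≤ (dom.card : ℝ) := by exact_mod_cast h1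
    rw [h2] at this
    exact_mod_cast this
  calc ∑ w ∈ F, t ^ wturns w ≤ ∑ w ∈ F, max 1 t ^ 3 := Finset.sum_le_sum hterm
    _ = F.card * max 1 t ^ 3 := by rw [Finset.sum_const, nsmul_eq_mul]
    _ ≤ (4 ^ 4 * ((N : ℝ) + 1) ^ 4) * max 1 t ^ 3 := mul_le_mul_of_nonneg_right hcard (by positivity)
    _ = max 1 t ^ 3 * (4 ^ 4 * ((N : ℝ) + 1) ^ 4) := by ring

end Literature.Probability.RandomPlanarGeometry.SAW
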